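import Literature.MathematicalPhysics.QuantumFieldTheory.Balaban1983to89.B5G183Kernel

/-!
# `Balaban1983to89.B5G183KernelSplit` — the kernel of `G = Δ_1⁻¹` on `T_η` SPLIT, for every truncation order `N`, into the resolvent polynomial `Σ_{j<N}(Δ+1)^{−(j+1)}` of the TYPED fine vector Laplacian (a scalar, fine-translation-invariant Fourier multiplier) plus the covariant part, whose block-point kernel IS the coarse-torus inverse DFT of pv15's fine-offset multiplier `B5G183CovDecay.Mcov`

T. Bałaban, *Propagators and renormalization transformations for lattice gauge theories. I*, Commun. Math.
Phys. **95**, 17–40 (1984) [`Balaban1984PropagatorsI`, cell paper B5].  What the paper PRINTS (verbatim; renders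
`b2b-balaban-ref1/pages/1984-cmp95-propagators-rt-I/…-p007-x2.png` (journal p. 23), `…-p015-x2.png` (p. 31),
`…-p020-x2.png` (p. 36) read as images by this seat; the same sentences are quoted in `B5G183Kernel`):
* p. 23 [PDF 7], (1.29): «f̃(p) = Σ_{x∈T′_η} η^d e^{−ip·x} f(x), p ∈ T̃′_η,   f(x) = (2π)^{−d} Σ_{p∈T̃′_η} (Π_{μ=1}^d π/L′_μ)
  e^{ix·p} f̃(p)» and «p ∈ T̃_η is represented as a sum p = p′ + l, p′ ∈ T̃₁^{(k)} and l = (l₁, …, l_d), l_μ = 2πm_μ, …»;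
* p. 31 [PDF 15]: «This gives the solution of Eq. (1.73), so G = Δ_a⁻¹. To investigate better the operator G we write
  it in momentum representation:» — formula (1.83), whose diagonal carries the free fine-lattice propagator factors
  `1/Δ(p′+l)` («for p′ ≠ 0,  Ã_μ(l) = 1/Δ(l) · J̃_μ(l)»);
* p. 36 [PDF 20], ll. 20–23 (the printed road to decay, NOT certified here): «Probably the simplest proof of the
  exponential decay properties can be obtained by relating G on the torus to G on the whole lattice ηℤ^d in the usual
  way, …».

CITATION HEADER (lean-in-tree rule).  This module is a SUPPLEMENT, not a quotation.  The pv15 lineage split the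
continued (1.83) entry symbol as `g183 = freeN N + g183cov N` (`B5G183CovSplit.g183_eq_freeN_add_cov`: the free part
`freeN = δ_{μν}δ_{ll′}R_N(Δ(p′+l))`, `R_N(z) = Σ_{j<N}(z+1)^{−(j+1)}` = `B5G183CovSplit.resolv`, and the covariant
regular remainder, whose fine-offset multiplier `Mcov = Σ_{l,l′} phase163·g183cov·phaseNeg` has the kernel decay of
`B5G183CovDecay`), and `B5G183Kernel` (this lineage) wrote the kernel of `Δ_1⁻¹` as the finite Fourier-inversion sum of
`g183`.  Below the two are JOINED at the level of the typed operator: the free part of the kernel is identified with the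
matrix entries of the resolvent polynomial `Σ_{j<N}((Lap + 1)⁻¹)^{j+1}` of the TYPED fine vector Laplacian
`Lap = Σ_ν ∇_ν^*∇_ν` (`B5Prop11Lower.Lap`, `Lap_eq`, `LapSym_emb` — pv15), and the covariant part on block points with
the coarse-torus inverse DFT of `Mcov` BY NAME.  Everything is `[folklore]` audit mathematics (functional calculus of
commuting Fourier multipliers on a finite torus); `[cite: …]` tags mark the location of printed TEXT only.  ABSOLUTE
RULE honoured: no statement of the papers is used as a hypothesis; the only import is the kernel-proved tree module
`B5G183Kernel` (⊇ `B5G183CovDecay ⊇ B5G183CovSplit`, `B5DeltaA169 ⊇ B5Prop11Lower`).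

CONTENT (all `n ≥ 1` where pv15's blocks need it, all `d`, every multi-period `M`, EVERY truncation order `N`).
§1 functional calculus of multipliers `F^* diag(D) F` on vector fields on any torus (`F = dftV`): products, `1`,
   powers, inverses (non-vanishing symbol), finite sums, entries (`mult_mul`, `mult_one`, `mult_pow`, `mult_inv`,
   `mult_sum`, `mult_apply` — the last via `B5G183Kernel.sandwich_apply`).
§2 the free part: `Lap + 1 = F^* diag(Δ(p)+1) F` (`LapOne_eq`), `(Lap+1)⁻¹ = F^* diag((Δ(p)+1)⁻¹) F` (`LapOne_inv_eq`),
   **`Σ_{j<N}((Lap+1)⁻¹)^{j+1} = F^* diag(R_N(Δ(p))) F`** (`resolventPowers_eq`), entrywise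
   `= δ_{μν}|T_η|^{−1}Σ_p e^{ip·x}R_N(Δ(p))e^{−ip·x′}` (`resolventPowers_apply`: a SCALAR, fine-translation-invariant
   kernel — the massive free propagator polynomial `Σ_{j<N}(−Δ^η+1)^{−(j+1)}` in coarse mass units), and in alias form
   with pv15's `freeN` at the real momenta `p′(q)` (`freeN_ofRealVec`, `resolventPowers_apply_alias`).
§3 **THE SPLIT** `(Δ_1⁻¹)_{(x,μ),(x′,ν)} = [Σ_{j<N}((Lap+1)⁻¹)^{j+1}]_{(x,μ),(x′,ν)} + |T_η|^{−1}Σ_qΣ_{l,l′} e^{i(p′_q+l)·x}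
   g^{cov,N}_{μν}(l,l′;p′_q) e^{−i(p′_q+l′)·x′}` (`DeltaA_one_inv_apply_split`), and ON BLOCK POINTS `x = n·y + r`
   **`(Δ_1⁻¹)_{(ny+r,μ),(ny′+r′,ν)} = [free]_{…} + |T_η|^{−1} Σ_{q∈T̃₁} e^{ip′_q·(y−y′)} · Mcov n N μ ν r r′ (p′_q)`**
   (`DeltaA_one_inv_apply_bpt_split`; `…_split'` with `|T₁|^{−1}·n^{−d}`): the covariant part of Bałaban's `G` between
   block points is EXACTLY the coarse-torus inverse DFT of the multiplier whose lattice / torus kernels decay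
   exponentially by `B5G183CovDecay.latticeKernel_Mcov_decay` / `torusKernel_Mcov_decay`.

HONEST SCOPE.  (i) IDENTITIES ONLY.  The matching of the finite `q`-sum `|T₁|^{−1}Σ_q e^{ip′_q·z}Mcov(p′_q)` with
`B4TorusKernel.MultiPeriod.torusKernel (descendC Mcov …) M z` (grid `ℤ/M ↔ Fin M`, characters `chi ↔ mFourier`, and the
coset representative: pv15's `p′(q) = sOf M q ∈ (−π, π]` versus `B4TorusKernel.rep ∈ [−1/2, 1/2)`, which differ exactly at
the antiperiodic grid points and are reconciled by the side periodicity `B5G183CovDecay.Mcov_tr`) — and with it the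
DECAY of the covariant part of the kernel of `G` — is NOT done in this leaf (next leaf of this lineage, or the consumer
t4-ne2-p2, GAPS G-ne2p2-9 (β)); nor is any decay of the free part asserted (it is the explicit massive free resolvent
polynomial; `B5G183FreeDecay` and its HONEST SCOPE (v) on `n`-uniformity apply).  (ii) `a = 1` (convention of
`B5G183Strip`); `U = 1`.  (iii) The free operator is `Σ_{j<N}((Lap n M + 1)⁻¹)^{j+1}` with pv15's `Lap` (symbol
`Δ(p) = Σ_ν|∂_ν(p)|²` in COARSE units, `η = 1/n`; mass `1` in coarse units); the `η^d`-normalisation dictionary of (1.29)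
is that of `B5DeltaA169`, not re-derived.  (iv) Finite torus only.  (v) No `def` is introduced: every object is an
existing tree declaration, used BY NAME; the resolvent polynomial is written out as a `Finset.range` sum in every
statement.
-/

open scoped BigOperators Matrix ComplexConjugate Matrix.Norms.L2Operator
open Finset Complex Matrix

namespace Literature.MathematicalPhysics.QuantumFieldTheory.Balaban1983to89.B5G183KernelSplit

open Literature.MathematicalPhysics.QuantumFieldTheory.Balaban1983to89.B4Strip
open Literature.MathematicalPhysics.QuantumFieldTheory.Balaban1983to89.B5Prop11Fiber
open Literature.MathematicalPhysics.QuantumFieldTheory.Balaban1983to89.B5Prop11Bound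
open Literature.MathematicalPhysics.QuantumFieldTheory.Balaban1983to89.B5Prop11Plancherel
open Literature.MathematicalPhysics.QuantumFieldTheory.Balaban1983to89.B5Prop11Lower (Lap LapSym Lap_eq LapSym_emb)
open Literature.MathematicalPhysics.QuantumFieldTheory.Balaban1983to89.B5Block118
  (cT conj_dft pOf emb_eq pOf_bijective bpt chi_pOf_up chi_pOf_iota)
open Literature.MathematicalPhysics.QuantumFieldTheory.Balaban1983to89.B5DeltaA169
open Literature.MathematicalPhysics.QuantumFieldTheory.Balaban1983to89.B5G183Strip (g183)
open Literature.MathematicalPhysics.QuantumFieldTheory.Balaban1983to89.B5G183CovSplit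
  (resolv freeN g183cov g183_eq_freeN_add_cov)
open Literature.MathematicalPhysics.QuantumFieldTheory.Balaban1983to89.B5Hk163Decay (phase163)
open Literature.MathematicalPhysics.QuantumFieldTheory.Balaban1983to89.B5G183CovDecay (phaseNeg Mcov)
open Literature.MathematicalPhysics.QuantumFieldTheory.Balaban1983to89.B5G183Kernel

variable {d : ℕ}

/-! ## §1. Functional calculus of Fourier multipliers `F^* diag(D) F` on vector fields on a torus -/

section Calculus

variable (N : Fin d → ℕ) [hN : ∀ μ, NeZero (N μ)]

/-- product of two multipliers: `(F^* D₁ F)(F^* D₂ F) = F^* (D₁D₂) F`. [folklore] -/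
theorem mult_mul (D₁ D₂ : Tor N × Fin d → ℂ) :
    star (dftV N) * Matrix.diagonal D₁ * dftV N * (star (dftV N) * Matrix.diagonal D₂ * dftV N)
      = star (dftV N) * Matrix.diagonal (fun i => D₁ i * D₂ i) * dftV N := by
  rw [← Matrix.diagonal_mul_diagonal]
  simp only [Matrix.mul_assoc]
  rw [← Matrix.mul_assoc (dftV N) (star (dftV N)), dftV_mul_star, Matrix.one_mul]

/-- the identity is the multiplier `1`: `F^* F = F^* diag(1) F = 1`. [folklore] -/
theorem mult_one : star (dftV N) * Matrix.diagonal (fun _ : Tor N × Fin d => (1 : ℂ)) * dftV N = 1 := by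
  rw [Matrix.diagonal_one, Matrix.mul_one, star_dftV_mul]

/-- powers of a multiplier: `(F^* D F)^m = F^* D^m F`. [folklore] -/
theorem mult_pow (D : Tor N × Fin d → ℂ) (m : ℕ) :
    (star (dftV N) * Matrix.diagonal D * dftV N) ^ m
      = star (dftV N) * Matrix.diagonal (fun i => D i ^ m) * dftV N := by
  induction m with
  | zero => simp only [pow_zero]; exact (mult_one N).symm
  | succ m ih =>
      rw [pow_succ, ih, mult_mul]
      simp only [pow_succ]

/-- inverse of a multiplier with non-vanishing symbol: `(F^* D F)⁻¹ = F^* D⁻¹ F`. [folklore] -/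
theorem mult_inv (D : Tor N × Fin d → ℂ) (hD : ∀ i, D i ≠ 0) :
    (star (dftV N) * Matrix.diagonal D * dftV N)⁻¹
      = star (dftV N) * Matrix.diagonal (fun i => (D i)⁻¹) * dftV N := by
  apply Matrix.inv_eq_right_inv
  rw [mult_mul]
  have h : (fun i => D i * (D i)⁻¹) = fun _ => (1 : ℂ) := funext fun i => mul_inv_cancel₀ (hD i)
  rw [h, mult_one]

/-- sums of multipliers: `Σ_j F^* E_j F = F^* (Σ_j E_j) F`. [folklore] -/
theorem mult_sum {ι : Type*} (s : Finset ι) (E : ι → Tor N × Fin d → ℂ) :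
    ∑ j ∈ s, star (dftV N) * Matrix.diagonal (E j) * dftV N
      = star (dftV N) * Matrix.diagonal (fun i => ∑ j ∈ s, E j i) * dftV N := by
  have hdiag : Matrix.diagonal (fun i => ∑ j ∈ s, E j i) = ∑ j ∈ s, Matrix.diagonal (E j) := by
    ext i k
    rw [Matrix.sum_apply]
    by_cases hik : i = k
    · subst hik
      simp only [Matrix.diagonal_apply_eq]
    · simp only [Matrix.diagonal_apply_ne _ hik, Finset.sum_const_zero]
  rw [hdiag, Finset.mul_sum, Finset.sum_mul]

/-- ENTRIES of a multiplier: `(F^* D F)_{(x,μ),(x′,ν)} = δ_{μν} |T|^{-1} Σ_p e^{ip·x} D(p,μ) e^{−ip·x′}`. [folklore] -/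
theorem mult_apply (D : Tor N × Fin d → ℂ) (x x' : Tor N) (μ ν : Fin d) :
    (star (dftV N) * Matrix.diagonal D * dftV N) (x, μ) (x', ν)
      = if μ = ν then ((Fintype.card (Tor N) : ℂ))⁻¹ *
          ∑ p : Tor N, chi N p x * D (p, μ) * conj (chi N p x') else 0 := by
  rw [sandwich_apply]
  by_cases h : μ = ν
  · subst h
    simp only [if_true, Matrix.diagonal_apply, Prod.mk.injEq, and_true, mul_ite, mul_zero, ite_mul,
      zero_mul, Finset.sum_ite_eq, Finset.mem_univ, if_true]
  · simp only [h, if_false, Matrix.diagonal_apply, Prod.mk.injEq, and_false, mul_zero,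
      zero_mul, Finset.sum_const_zero, mul_zero]

end Calculus

/-! ## §2. The resolvent powers `Σ_{j<N} (Δ + 1)^{−(j+1)}` of the typed fine vector Laplacian `Lap` -/

section Free

variable (n : ℕ) [NeZero n] (M : Fin d → ℕ) [hM : ∀ μ, NeZero (M μ)]

/-- `Δ + 1 = F^* diag(Δ(p) + 1) F` (`B5Prop11Lower.Lap_eq`). [folklore] -/
theorem LapOne_eq :
    Lap n M + 1 = star (dftV (fine n M)) * Matrix.diagonal (fun i => ((LapSym n M i : ℂ) + 1))
      * dftV (fine n M) := by
  conv_lhs => rw [Lap_eq, ← mult_one (fine n M)]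
  rw [← Matrix.add_mul, ← Matrix.mul_add, Matrix.diagonal_add]

/-- `Δ(p) + 1 ≠ 0` (`Δ(p) ≥ 0`). [folklore] -/
theorem LapSym_add_one_ne_zero (i : Tor (fine n M) × Fin d) : (LapSym n M i : ℂ) + 1 ≠ 0 := by
  have h0 : 0 ≤ LapSym n M i := by
    unfold LapSym; positivity
  have h1 : (0 : ℝ) < LapSym n M i + 1 := by linarith
  exact_mod_cast h1.ne'

/-- `(Δ + 1)⁻¹ = F^* diag((Δ(p)+1)⁻¹) F`. [folklore] -/
theorem LapOne_inv_eq :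
    (Lap n M + 1)⁻¹ = star (dftV (fine n M)) * Matrix.diagonal (fun i => ((LapSym n M i : ℂ) + 1)⁻¹)
      * dftV (fine n M) := by
  rw [LapOne_eq, mult_inv _ _ (LapSym_add_one_ne_zero n M)]

/-- **RESOLVENT POWERS OF THE FINE VECTOR LAPLACIAN AS A FOURIER MULTIPLIER**: for every `N`,
`Σ_{j<N} ((Δ + 1)⁻¹)^{j+1} = F^* diag(R_N(Δ(p))) F`, `R_N = B5G183CovSplit.resolv N`. [folklore] -/
theorem resolventPowers_eq (N : ℕ) :
    ∑ j ∈ Finset.range N, ((Lap n M + 1)⁻¹) ^ (j + 1)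
      = star (dftV (fine n M)) * Matrix.diagonal (fun i => resolv N (LapSym n M i : ℂ)) * dftV (fine n M) := by
  rw [LapOne_inv_eq]
  simp_rw [mult_pow, mult_sum]
  congr 2
  funext i
  simp only [resolv, one_div, inv_pow]

/-- entrywise: `[Σ_{j<N}((Δ+1)⁻¹)^{j+1}]_{(x,μ),(x′,ν)} = δ_{μν}|T_η|^{-1} Σ_p e^{ip·x} R_N(Δ(p)) e^{−ip·x′}` — a SCALAR,
fine-translation-invariant kernel (the massive free propagator polynomial). [folklore] -/
theorem resolventPowers_apply (N : ℕ) (x x' : Tor (fine n M)) (μ ν : Fin d) :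
    (∑ j ∈ Finset.range N, ((Lap n M + 1)⁻¹) ^ (j + 1)) (x, μ) (x', ν)
      = if μ = ν then ((Fintype.card (Tor (fine n M)) : ℂ))⁻¹ *
          ∑ p : Tor (fine n M), chi (fine n M) p x * resolv N (LapSym n M (p, μ) : ℂ) * conj (chi (fine n M) p x')
        else 0 := by
  rw [resolventPowers_eq, mult_apply]

/-- the symbol on the coset `p = p′ + l`: `R_N(Δ(p′+l)) = freeN`'s diagonal value at the real momentum `p′(q)`.
[folklore] -/
theorem freeN_ofRealVec (N : ℕ) (μ ν : Fin d) (k k' : Fin d → Fin n) (q : Tor M) :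
    freeN n N μ ν k k' (ofRealVec (sOf M q))
      = if μ = ν ∧ k = k' then resolv N (LapSym n M (pOf n M (k, q), μ) : ℂ) else 0 := by
  rw [freeN, shift_ofReal, DeltaXi_ofReal, ← emb_eq, LapSym_emb]

/-- **THE FREE PART IN ALIAS FORM**: `[Σ_{j<N}((Δ+1)⁻¹)^{j+1}]_{(x,μ),(x′,ν)}
= |T_η|^{-1} Σ_{q} Σ_{l,l′} e^{i(p′_q+l)·x} freeN_{μν}(l,l′;p′_q) e^{−i(p′_q+l′)·x′}` — the same shape as
`B5G183Kernel.DeltaA_one_inv_apply` with `freeN` in place of `g183`. [folklore] -/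
theorem resolventPowers_apply_alias (N : ℕ) (x x' : Tor (fine n M)) (μ ν : Fin d) :
    (∑ j ∈ Finset.range N, ((Lap n M + 1)⁻¹) ^ (j + 1)) (x, μ) (x', ν)
      = ((Fintype.card (Tor (fine n M)) : ℂ))⁻¹ *
          ∑ q : Tor M, ∑ k : Fin d → Fin n, ∑ k' : Fin d → Fin n,
            chi (fine n M) (pOf n M (k, q)) x * freeN n N μ ν k k' (ofRealVec (sOf M q))
              * conj (chi (fine n M) (pOf n M (k', q)) x') := by
  rw [resolventPowers_apply]
  simp_rw [freeN_ofRealVec]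
  by_cases h : μ = ν
  · subst h
    simp only [if_true, true_and, mul_ite, mul_zero, ite_mul, zero_mul, Finset.sum_ite_eq, Finset.mem_univ]
    congr 1
    rw [sum_pOf n M, Fintype.sum_prod_type, Finset.sum_comm]
  · simp only [h, if_false, false_and, mul_zero, zero_mul, Finset.sum_const_zero, mul_zero]

end Free

/-! ## §3. THE SPLIT of `G = Δ_1⁻¹` into the free resolvent polynomial and the covariant part -/

section Split

variable (n : ℕ) [NeZero n] (hn : 1 ≤ n) (M : Fin d → ℕ) [hM : ∀ μ, NeZero (M μ)]

include hn in
/-- **`Δ_1⁻¹ = Σ_{j<N}(Δ+1)^{−(j+1)} ⊗ 1 + K^{cov,N}` ENTRYWISE**: for `a = 1`, every `n ≥ 1`, every truncation order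
`N` and all `(x,μ), (x′,ν)`,
`(Δ_1⁻¹)_{(x,μ),(x′,ν)} = [Σ_{j<N}((Δ+1)⁻¹)^{j+1}]_{(x,μ),(x′,ν)}
  + |T_η|^{-1} Σ_q Σ_{l,l′} e^{i(p′_q+l)·x} g^{cov,N}_{μν}(l,l′;p′_q) e^{−i(p′_q+l′)·x′}`
(`B5G183CovSplit.g183_eq_freeN_add_cov` inside `B5G183Kernel.DeltaA_one_inv_apply`). [folklore] -/
theorem DeltaA_one_inv_apply_split (N : ℕ) (x x' : Tor (fine n M)) (μ ν : Fin d) :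
    (DeltaA n M 1)⁻¹ (x, μ) (x', ν)
      = (∑ j ∈ Finset.range N, ((Lap n M + 1)⁻¹) ^ (j + 1)) (x, μ) (x', ν)
        + ((Fintype.card (Tor (fine n M)) : ℂ))⁻¹ *
          ∑ q : Tor M, ∑ k : Fin d → Fin n, ∑ k' : Fin d → Fin n,
            chi (fine n M) (pOf n M (k, q)) x * g183cov n N μ ν k k' (ofRealVec (sOf M q))
              * conj (chi (fine n M) (pOf n M (k', q)) x') := by
  rw [DeltaA_one_inv_apply n hn M, resolventPowers_apply_alias, ← mul_add, ← Finset.sum_add_distrib]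
  refine congrArg _ (Finset.sum_congr rfl fun q _ => ?_)
  rw [← Finset.sum_add_distrib]
  refine Finset.sum_congr rfl fun k _ => ?_
  rw [← Finset.sum_add_distrib]
  refine Finset.sum_congr rfl fun k' _ => ?_
  rw [g183_eq_freeN_add_cov n N]
  ring

include hn in
/-- **THE COVARIANT PART ON BLOCK POINTS IS THE COARSE-TORUS INVERSE DFT OF `Mcov`**: for `a = 1`, `n ≥ 1`, every `N`,
`y, y′ ∈ T₁`, `r, r′ ∈ {0,…,n−1}^d`,
`(Δ_1⁻¹)_{(ny+r,μ),(ny′+r′,ν)} = [Σ_{j<N}((Δ+1)⁻¹)^{j+1}]_{(ny+r,μ),(ny′+r′,ν)}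
  + |T_η|^{-1} Σ_{q ∈ T̃₁} e^{ip′_q·(y−y′)} · M^{cov,N}_{r r′;μν}(p′_q)`
with `M^{cov,N} = B5G183CovDecay.Mcov n N μ ν r r′` BY NAME. [folklore] -/
theorem DeltaA_one_inv_apply_bpt_split (N : ℕ) (y y' : Tor M) (r r' : Fin d → Fin n) (μ ν : Fin d) :
    (DeltaA n M 1)⁻¹ (bpt n M y r, μ) (bpt n M y' r', ν)
      = (∑ j ∈ Finset.range N, ((Lap n M + 1)⁻¹) ^ (j + 1)) (bpt n M y r, μ) (bpt n M y' r', ν)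
        + ((Fintype.card (Tor (fine n M)) : ℂ))⁻¹ *
          ∑ q : Tor M, chi M q (y - y') * Mcov n N μ ν r r' (ofRealVec (sOf M q)) := by
  rw [DeltaA_one_inv_apply_split n hn M N]
  congr 1
  refine congrArg _ (Finset.sum_congr rfl fun q _ => ?_)
  have hsub : chi M q (y - y') = chi M q y * conj (chi M q y') := by
    rw [sub_eq_add_neg, chi_add_right, conj_chi, ← chi_neg_neg M (-q) y', neg_neg]
  rw [hsub, Mcov, Finset.mul_sum]
  refine Finset.sum_congr rfl fun k _ => ?_
  rw [Finset.mul_sum]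
  refine Finset.sum_congr rfl fun k' _ => ?_
  rw [chi_pOf_bpt, chi_pOf_bpt, map_mul, conj_phase163_ofRealVec]
  ring

include hn in
/-- the same with the normalisation split `|T_η|^{-1} = |T₁|^{-1}·n^{-d}`: the covariant part is
`|T₁|^{-1} Σ_q e^{ip′_q·(y−y′)} · (n^{-d} M^{cov,N}_{r r′;μν}(p′_q))`. [folklore] -/
theorem DeltaA_one_inv_apply_bpt_split' (N : ℕ) (y y' : Tor M) (r r' : Fin d → Fin n) (μ ν : Fin d) :
    (DeltaA n M 1)⁻¹ (bpt n M y r, μ) (bpt n M y' r', ν)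
      = (∑ j ∈ Finset.range N, ((Lap n M + 1)⁻¹) ^ (j + 1)) (bpt n M y r, μ) (bpt n M y' r', ν)
        + ((Fintype.card (Tor M) : ℂ))⁻¹ *
          ∑ q : Tor M, chi M q (y - y') * (((n : ℂ) ^ d)⁻¹ * Mcov n N μ ν r r' (ofRealVec (sOf M q))) := by
  rw [DeltaA_one_inv_apply_bpt_split n hn M N, card_Tor_fine, mul_comm ((n : ℂ) ^ d), mul_inv, mul_assoc]
  congr 1
  refine congrArg (fun s => ((Fintype.card (Tor M) : ℂ))⁻¹ * s) ?_
  rw [Finset.mul_sum]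
  exact Finset.sum_congr rfl fun q _ => by ring

end Split

end Literature.MathematicalPhysics.QuantumFieldTheory.Balaban1983to89.B5G183KernelSplit
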